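import Mathlib.RingTheory.DedekindDomain.Ideal.Lemmas
import Mathlib.RingTheory.Ideal.BigOperators
import HarnessLib

/-!
# CRT idempotent families in a Dedekind domain: `e_i ≡ δ_{ij} (mod P_j^{n_j})`, hence `Σ e_i ≡ 1`, `e_i² ≡ e_i`, `e_i e_j ≡ 0`, `P_i^{n_i}·e_i ≡ 0`
# modulo `∏ P_j^{n_j}` ([Neukirch1999] Ch. I §3 (3.6); [SerreLocalFields1979] Ch. I §3)

Topic `Literature/RingTheory/DedekindDomain`; namespace `Literature.RingTheory.DedekindDomain`.  THEOREMS ONLY (no definition, no named fact, no instance, no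
notation, no `sorry`); Mathlib-only imports.  Cell `hodgecm-mathlib` (D-0151), P6 «MOD» (crux hLiu418 = stmt-HodgeConjecture-24832, `--supports`, count-neutral): line L3 ROOF
road, organ (rL-asm) — the inputs `s, e, hsum, hidem` («`Σ e_i − 1 ∈ (q)`, `e_i² − e_i ∈ (q)`») of ★ `FrobeniusKernelLawBlockAssembly.comp_relFrobeniusOver_eq_one_iff_of_torsion_blocks`
and `h𝔟e` («`𝔭_i^{n_i} · e_i ⊆ (q)`») of its banal bridge `blockLaw_of_idealTorsionLaw`, for the FULL finite family of primes dividing `q` (★ (O-CRT)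
`BlockIdempotentFamily.exists_blockIdempotentFamily` is the two-block `w`-versus-cofactor case).  HC_CM is proved only modulo the printed citations until rung 0 closes; this
file is generic and changes no count.

THE MATHEMATICS ([Neukirch1999] I (3.6), the Chinese remainder theorem `R ⁄ ∏ P_j^{n_j} ≅ ∏ R ⁄ P_j^{n_j}` for distinct nonzero primes of a Dedekind domain; Mathlib
`IsDedekindDomain.exists_forall_sub_mem_ideal`, `IsDedekindDomain.inf_pow_eq_prod_of_prime`).  For a finite family of distinct nonzero primes `P_j` and exponents `n_j`
there are `e_i ∈ R` with `e_i ≡ 1 (mod P_i^{n_i})` and `e_i ≡ 0 (mod P_j^{n_j})`, `j ≠ i` (the KRONECKER family, §1).  Since membership in `Q := ∏ P_j^{n_j} = ⋂ P_j^{n_j}` is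
checked prime by prime (§2 `mem_prod_pow_iff`), such a family satisfies `Σ_i e_i − 1 ∈ Q`, `e_i² − e_i = e_i (e_i − 1) ∈ Q`, `e_i e_j ∈ Q` (`i ≠ j`), and `b e_i ∈ Q` for
`b ∈ P_i^{n_i}` (§2) — the lifts to `R` of the primitive idempotents of `R ⁄ Q`.  §3 packages this for the prime factorisation of any nonzero ideal `I`
(`I = ∏_{P ∈ factors} P^{count}`, Mathlib `Ideal.prod_normalizedFactors_eq_self` + `Finset.prod_multiset_count`), e.g. `I = (q)`.

* §1 `exists_kroneckerFamily`;
* §2 `mem_prod_pow_iff`, `sum_sub_one_mem_prod_pow`, `mul_self_sub_mem_prod_pow`, `mul_mem_prod_pow_of_ne`, `mul_mem_prod_pow_of_mem_pow`, **`exists_crtIdempotentFamily`**;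
* §3 `prod_toFinset_normalizedFactors_pow_count`, **`exists_crtIdempotentFamily_normalizedFactors`** (any nonzero ideal), **`exists_crtIdempotentFamily_span_singleton`** (`I = (q)`).

## References
* [Neukirch1999] J. Neukirch, *Algebraic Number Theory* (1999), Ch. I §3, (3.6) (Chinese remainder theorem) and (3.3).
* [SerreLocalFields1979] J.-P. Serre, *Local Fields*, GTM 67 (1979), Ch. I §3.
-/

set_option autoImplicit false

namespace Literature.RingTheory.DedekindDomain

open IsDedekindDomain UniqueFactorizationMonoid

variable {R : Type*} [CommRing R] [IsDedekindDomain R] {ι : Type*}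

/-! ## §1 The Kronecker family -/

/-- **KRONECKER CRT FAMILY**: for distinct nonzero primes `P_j` (`j ∈ s`) and exponents `n_j` there are `e_i` with `e_i − 1 ∈ P_i^{n_i}` and `e_i ∈ P_j^{n_j}` for
`j ≠ i` (Mathlib `IsDedekindDomain.exists_forall_sub_mem_ideal` with the targets `δ_{ij}`). [cite: Neukirch1999, Ch. I §3 (3.6)] -/
theorem exists_kroneckerFamily (s : Finset ι) (P : ι → Ideal R) (n : ι → ℕ) (hprime : ∀ i ∈ s, Prime (P i))
    (hne : ∀ᵉ (i ∈ s) (j ∈ s), i ≠ j → P i ≠ P j) :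
    ∃ e : ι → R, (∀ i ∈ s, e i - 1 ∈ P i ^ n i) ∧ ∀ i ∈ s, ∀ j ∈ s, j ≠ i → e i ∈ P j ^ n j := by
  classical
  have h : ∀ i : ι, ∃ y : R, i ∈ s → (y - 1 ∈ P i ^ n i ∧ ∀ j ∈ s, j ≠ i → y ∈ P j ^ n j) := by
    intro i
    by_cases hi : i ∈ s
    · obtain ⟨y, hy⟩ := exists_forall_sub_mem_ideal P n hprime hne fun j : s => if (j : ι) = i then (1 : R) else 0
      refine ⟨y, fun _ => ⟨?_, fun j hj hji => ?_⟩⟩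
      · simpa using hy i hi
      · simpa [hji] using hy j hj
    · exact ⟨0, fun h => (hi h).elim⟩
  choose e he using h
  exact ⟨e, fun i hi => (he i hi).1, fun i hi => (he i hi).2⟩

/-! ## §2 Consequences modulo `∏ P_j^{n_j}` -/

/-- Membership in `∏_{j ∈ s} P_j^{n_j}` is membership in every `P_j^{n_j}` (distinct primes: the product is the intersection, Mathlib
`IsDedekindDomain.inf_pow_eq_prod_of_prime`). [cite: Neukirch1999, Ch. I §3 (3.6)] -/
theorem mem_prod_pow_iff (s : Finset ι) (P : ι → Ideal R) (n : ι → ℕ) (hprime : ∀ i ∈ s, Prime (P i))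
    (hne : ∀ᵉ (i ∈ s) (j ∈ s), i ≠ j → P i ≠ P j) (x : R) :
    x ∈ ∏ j ∈ s, P j ^ n j ↔ ∀ j ∈ s, x ∈ P j ^ n j := by
  rw [← inf_pow_eq_prod_of_prime s P n hprime hne, Submodule.mem_finsetInf]

section Family

variable {s : Finset ι} {P : ι → Ideal R} {n : ι → ℕ} (hprime : ∀ i ∈ s, Prime (P i))
  (hne : ∀ᵉ (i ∈ s) (j ∈ s), i ≠ j → P i ≠ P j) {e : ι → R}
  (h1 : ∀ i ∈ s, e i - 1 ∈ P i ^ n i) (h0 : ∀ i ∈ s, ∀ j ∈ s, j ≠ i → e i ∈ P j ^ n j)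

include hprime hne h1 h0 in
/-- `Σ_{i ∈ s} e_i − 1 ∈ ∏ P_j^{n_j}`: modulo `P_j^{n_j}` the sum is `e_j ≡ 1`. [cite: Neukirch1999, Ch. I §3 (3.6)] -/
theorem sum_sub_one_mem_prod_pow : (∑ i ∈ s, e i) - 1 ∈ ∏ j ∈ s, P j ^ n j := by
  classical
  rw [mem_prod_pow_iff s P n hprime hne]
  intro j hj
  rw [← Finset.add_sum_erase s e hj, add_sub_right_comm]
  exact Ideal.add_mem _ (h1 j hj) (Ideal.sum_mem _ fun i hi => h0 i (Finset.mem_of_mem_erase hi) j hj (Finset.ne_of_mem_erase hi).symm)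

include hprime hne h1 h0 in
/-- `e_i² − e_i ∈ ∏ P_j^{n_j}` (`= e_i (e_i − 1)`; the second factor vanishes mod `P_i^{n_i}`, the first mod the others). [cite: Neukirch1999, Ch. I §3 (3.6)] -/
theorem mul_self_sub_mem_prod_pow {i : ι} (hi : i ∈ s) : e i * e i - e i ∈ ∏ j ∈ s, P j ^ n j := by
  rw [mem_prod_pow_iff s P n hprime hne, show e i * e i - e i = e i * (e i - 1) by ring]
  intro j hj
  by_cases hji : j = i
  · subst hji
    exact Ideal.mul_mem_left _ _ (h1 j hj)
  · exact Ideal.mul_mem_right _ _ (h0 i hi j hj hji)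

include hprime hne h0 in
/-- `e_i e_k ∈ ∏ P_j^{n_j}` for `i ≠ k`. [cite: Neukirch1999, Ch. I §3 (3.6)] -/
theorem mul_mem_prod_pow_of_ne {i k : ι} (hi : i ∈ s) (hk : k ∈ s) (hik : i ≠ k) : e i * e k ∈ ∏ j ∈ s, P j ^ n j := by
  rw [mem_prod_pow_iff s P n hprime hne]
  intro j hj
  by_cases hji : j = i
  · subst hji
    exact Ideal.mul_mem_left _ _ (h0 k hk j hj hik)
  · exact Ideal.mul_mem_right _ _ (h0 i hi j hj hji)

include hprime hne h0 in
/-- `b e_i ∈ ∏ P_j^{n_j}` for `b ∈ P_i^{n_i}` (ABSORPTION: the `i`-th prime power kills `e_i` modulo the product — the `h𝔟e` input of the banal bridge).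
[cite: Neukirch1999, Ch. I §3 (3.6)] -/
theorem mul_mem_prod_pow_of_mem_pow {i : ι} (hi : i ∈ s) {b : R} (hb : b ∈ P i ^ n i) : b * e i ∈ ∏ j ∈ s, P j ^ n j := by
  rw [mem_prod_pow_iff s P n hprime hne]
  intro j hj
  by_cases hji : j = i
  · subst hji
    exact Ideal.mul_mem_right _ _ hb
  · exact Ideal.mul_mem_left _ _ (h0 i hi j hj hji)

end Family

/-- **CRT IDEMPOTENT FAMILY modulo `Q = ∏_{j ∈ s} P_j^{n_j}`** (distinct nonzero primes of a Dedekind domain): `e : ι → R` with `e_i − 1 ∈ P_i^{n_i}`, `e_i ∈ P_j^{n_j}`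
(`j ≠ i`), `Σ e_i − 1 ∈ Q`, `e_i² − e_i ∈ Q`, `e_i e_k ∈ Q` (`i ≠ k`), `b e_i ∈ Q` (`b ∈ P_i^{n_i}`). [cite: Neukirch1999, Ch. I §3 (3.6)] [cite: SerreLocalFields1979, Ch. I §3] -/
theorem exists_crtIdempotentFamily (s : Finset ι) (P : ι → Ideal R) (n : ι → ℕ) (hprime : ∀ i ∈ s, Prime (P i))
    (hne : ∀ᵉ (i ∈ s) (j ∈ s), i ≠ j → P i ≠ P j) :
    ∃ e : ι → R, (∀ i ∈ s, e i - 1 ∈ P i ^ n i) ∧ (∀ i ∈ s, ∀ j ∈ s, j ≠ i → e i ∈ P j ^ n j) ∧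
      (∑ i ∈ s, e i) - 1 ∈ ∏ j ∈ s, P j ^ n j ∧ (∀ i ∈ s, e i * e i - e i ∈ ∏ j ∈ s, P j ^ n j) ∧
      (∀ i ∈ s, ∀ k ∈ s, i ≠ k → e i * e k ∈ ∏ j ∈ s, P j ^ n j) ∧
      ∀ i ∈ s, ∀ b ∈ P i ^ n i, b * e i ∈ ∏ j ∈ s, P j ^ n j := by
  obtain ⟨e, h1, h0⟩ := exists_kroneckerFamily s P n hprime hne
  exact ⟨e, h1, h0, sum_sub_one_mem_prod_pow hprime hne h1 h0, fun i hi => mul_self_sub_mem_prod_pow hprime hne h1 h0 hi,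
    fun i hi k hk hik => mul_mem_prod_pow_of_ne hprime hne h0 hi hk hik, fun i hi b hb => mul_mem_prod_pow_of_mem_pow hprime hne h0 hi hb⟩

/-! ## §3 The family attached to the prime factorisation of a nonzero ideal -/

/-- `I = ∏_{P ∈ factors(I)} P^{count P}` for a nonzero ideal of a Dedekind domain (Mathlib `Ideal.prod_normalizedFactors_eq_self`, grouped by `Finset.prod_multiset_count`).
[cite: Neukirch1999, Ch. I §3 (3.3)] -/
theorem prod_toFinset_normalizedFactors_pow_count [DecidableEq (Ideal R)] {I : Ideal R} (hI : I ≠ ⊥) :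
    ∏ P ∈ (normalizedFactors I).toFinset, P ^ (normalizedFactors I).count P = I := by
  rw [← Finset.prod_multiset_count]
  exact Ideal.prod_normalizedFactors_eq_self hI

/-- **CRT IDEMPOTENT FAMILY OF A NONZERO IDEAL `I`**, indexed by its prime factors `P` with exponents `count P`: `e_P − 1 ∈ P^{v_P(I)}`, `e_P ∈ P′^{v_{P′}(I)}` (`P′ ≠ P`),
`Σ e_P − 1 ∈ I`, `e_P² − e_P ∈ I`, `e_P e_{P′} ∈ I`, `P^{v_P(I)} · e_P ⊆ I`. [cite: Neukirch1999, Ch. I §3 (3.6)] [cite: SerreLocalFields1979, Ch. I §3] -/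
theorem exists_crtIdempotentFamily_normalizedFactors [DecidableEq (Ideal R)] {I : Ideal R} (hI : I ≠ ⊥) :
    ∃ e : Ideal R → R,
      (∀ P ∈ (normalizedFactors I).toFinset, e P - 1 ∈ P ^ (normalizedFactors I).count P) ∧
      (∀ P ∈ (normalizedFactors I).toFinset, ∀ P' ∈ (normalizedFactors I).toFinset, P' ≠ P → e P ∈ P' ^ (normalizedFactors I).count P') ∧
      (∑ P ∈ (normalizedFactors I).toFinset, e P) - 1 ∈ I ∧
      (∀ P ∈ (normalizedFactors I).toFinset, e P * e P - e P ∈ I) ∧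
      (∀ P ∈ (normalizedFactors I).toFinset, ∀ P' ∈ (normalizedFactors I).toFinset, P ≠ P' → e P * e P' ∈ I) ∧
      ∀ P ∈ (normalizedFactors I).toFinset, ∀ b ∈ P ^ (normalizedFactors I).count P, b * e P ∈ I := by
  have hprime : ∀ P ∈ (normalizedFactors I).toFinset, Prime ((fun P : Ideal R => P) P) := fun P hP =>
    prime_of_normalized_factor P (Multiset.mem_toFinset.mp hP)
  have hne : ∀ᵉ (P ∈ (normalizedFactors I).toFinset) (P' ∈ (normalizedFactors I).toFinset), P ≠ P' → (fun P : Ideal R => P) P ≠ P' :=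
    fun P _ P' _ h => h
  obtain ⟨e, h1, h0, hsum, hidem, hmul, habs⟩ :=
    exists_crtIdempotentFamily (normalizedFactors I).toFinset (fun P : Ideal R => P) (fun P => (normalizedFactors I).count P) hprime hne
  rw [prod_toFinset_normalizedFactors_pow_count hI] at hsum hidem hmul habs
  exact ⟨e, h1, h0, hsum, hidem, hmul, habs⟩

/-- **CRT IDEMPOTENT FAMILY MODULO A NONZERO ELEMENT `q`** (`I = (q)`; the use: `q = p^r` in `𝒪_F`, indices = the primes over `p`): the `hsum`∕`hidem` inputs of the
all-`T` Frobenius-kernel assembly and the absorption `h𝔟e` of its banal bridge, for ONE family. [cite: Neukirch1999, Ch. I §3 (3.6)] [cite: SerreLocalFields1979, Ch. I §3] -/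
theorem exists_crtIdempotentFamily_span_singleton [DecidableEq (Ideal R)] {q : R} (hq : q ≠ 0) :
    ∃ e : Ideal R → R,
      (∀ P ∈ (normalizedFactors (Ideal.span {q})).toFinset, e P - 1 ∈ P ^ (normalizedFactors (Ideal.span {q})).count P) ∧
      (∀ P ∈ (normalizedFactors (Ideal.span {q})).toFinset, ∀ P' ∈ (normalizedFactors (Ideal.span {q})).toFinset, P' ≠ P →
        e P ∈ P' ^ (normalizedFactors (Ideal.span {q})).count P') ∧
      (∑ P ∈ (normalizedFactors (Ideal.span {q})).toFinset, e P) - 1 ∈ Ideal.span {q} ∧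
      (∀ P ∈ (normalizedFactors (Ideal.span {q})).toFinset, e P * e P - e P ∈ Ideal.span {q}) ∧
      (∀ P ∈ (normalizedFactors (Ideal.span {q})).toFinset, ∀ P' ∈ (normalizedFactors (Ideal.span {q})).toFinset, P ≠ P' → e P * e P' ∈ Ideal.span {q}) ∧
      ∀ P ∈ (normalizedFactors (Ideal.span {q})).toFinset, ∀ b ∈ P ^ (normalizedFactors (Ideal.span {q})).count P, b * e P ∈ Ideal.span {q} :=
  exists_crtIdempotentFamily_normalizedFactors (by rwa [Ne, Ideal.span_singleton_eq_bot])

end Literature.RingTheory.DedekindDomain
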